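import Mathlib

/-!
# Welding rigidity, III: gluing the two transition maps along the chord

Support file for item `stmt-CriticalPhenomena-4505` (`WeldingRigidity`, route
`SAWWeldingIdentification`). Pure point-set bookkeeping, stated for abstract data so that it
elaborates against Mathlib alone:

* `Ω` an open set, `G` (the chord) with `G ∖ {a, b} ⊆ Ω`, banks `L ⊔ R = Ω ∖ G` (open) with
  `G ⊆ ∂L ∩ ∂R` and `Ω ∩ ∂L, Ω ∩ ∂R ⊆ G`; the same for a second chord `G'` with banks `L', R'`;
* transition maps `T_L` (continuous on `L̄`, a holomorphic bijection `L → L'`) and `T_R`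
  (likewise `R → R'`), and boundary correspondences `eψ, eψ' : ℝ → ℂ` of the right banks with
  `T_R ∘ eψ = eψ'`, a ray `X ⊆ ℝ` parametrising `G ∖ {a, b}` by `eψ` and `G' ∖ {a, b}` by `eψ'`.

Results: `eqOn_of_welding` — if the weldings agree on the positive rationals then `T_L = T_R` on
`G ∖ {a, b}` (density + continuity); `continuousOn_glued`, `differentiableOn_glued`,
`injOn_glued`, `image_glued`, `image_chord_glued`, `tendsto_glued` — the glued map
`F = L.piecewise T_L T_R` is a continuous bijection `Ω → Ω`, holomorphic off `G`, mapping
`G ∖ {a, b}` onto `G' ∖ {a, b}`, with the expected boundary limits. All folklore; no definitions.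
-/

noncomputable section

open Set Filter Metric Topology Complex

namespace Summit.CriticalPhenomena.SAWScalingLimit.Theorems.WeldingRigidity

/-! ### Agreement of the two transition maps on the chord, from the welding -/

/-- **The weldings agree on `ℚ₊` ⇒ the transition maps agree on the chord.** With
`g₁ x = T_L (eψ (s x))` and `g₂ x = eψ' (s x)` (`x > 0`): both are continuous, they agree at
rational `x` by the two welding identities and `T_L ∘ eφ = eφ'`, hence everywhere (density);
and every point of `G ∖ {a, b}` is `eψ (s x)` for some `x > 0`. [folklore] -/
theorem eqOn_of_welding {TL TR : ℂ → ℂ} {eφ eψ eφ' eψ' : ℝ → ℂ} {L G : Set ℂ} {a b : ℂ}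
    {s : ℝ} {h : ℚ → ℝ} (hs : s = 1 ∨ s = -1)
    (hTLc : ContinuousOn TL (closure L)) (hGL : G \ {a, b} ⊆ closure L)
    (heψ : Continuous eψ) (heψ' : Continuous eψ')
    (hTLφ : ∀ y : ℝ, TL (eφ y) = eφ' y) (hTRψ : ∀ x : ℝ, TR (eψ x) = eψ' x)
    (hray : ∀ x : ℝ, 0 < s * x → eψ x ∈ G \ {a, b})
    (hsurj : ∀ z ∈ G \ {a, b}, ∃ x : ℝ, 0 < s * x ∧ eψ x = z)
    (hw : ∀ q : ℚ, 0 < q → eψ (s * q) = eφ (-(s * h q)) ∧ eψ' (s * q) = eφ' (-(s * h q))) :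
    EqOn TL TR (G \ {a, b}) := by
  have hss : s * s = 1 := by rcases hs with rfl | rfl <;> norm_num
  set g₁ : ℝ → ℂ := fun x => TL (eψ (s * x)) with hg₁
  set g₂ : ℝ → ℂ := fun x => eψ' (s * x) with hg₂
  have hsmul : Continuous fun x : ℝ => s * x := continuous_const.mul continuous_id
  have hg₁c : ContinuousOn g₁ (Ioi 0) := by
    refine hTLc.comp (heψ.comp hsmul).continuousOn fun x hx => hGL (hray (s * x) ?_)
    have : s * (s * x) = x := by rw [← mul_assoc, hss, one_mul]
    rw [this]
    exact hx
  have hg₂c : ContinuousOn g₂ (Ioi 0) := (heψ'.comp hsmul).continuousOn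
  -- agreement at positive rationals
  have hrat : EqOn g₁ g₂ (Ioi 0 ∩ range ((↑) : ℚ → ℝ)) := by
    rintro _ ⟨hq, q, rfl⟩
    have hq' : (0 : ℚ) < q := by exact_mod_cast (mem_Ioi.1 hq)
    obtain ⟨hw₁, hw₂⟩ := hw q hq'
    simp only [hg₁, hg₂]
    rw [hw₁, hTLφ, hw₂]
  -- density of the positive rationals in `(0, ∞)`
  have hdense : Ioi (0 : ℝ) ⊆ closure (Ioi 0 ∩ range ((↑) : ℚ → ℝ)) :=
    Rat.denseRange_cast.open_subset_closure_inter isOpen_Ioi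
  have hall : EqOn g₁ g₂ (Ioi 0) :=
    hrat.of_subset_closure hg₁c hg₂c inter_subset_left hdense
  intro z hz
  obtain ⟨x, hx, rfl⟩ := hsurj z hz
  have hxu : s * (s * x) = x := by rw [← mul_assoc, hss, one_mul]
  have h1 : g₁ (s * x) = g₂ (s * x) := hall hx
  simp only [hg₁, hg₂, hxu] at h1
  rw [h1, hTRψ]

/-! ### The glued map -/

section Glued

variable {Ω L R L' R' G G' : Set ℂ} {a b : ℂ} {TL TR : ℂ → ℂ}

/-- Trichotomy in `Ω`: a point of `Ω` is in `L`, in `R`, or on the chord off its endpoints.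
[folklore] -/
theorem mem_cases (hLR : L ∪ R = Ω \ G) (ha : a ∉ Ω) (hb : b ∉ Ω) {z : ℂ} (hz : z ∈ Ω) :
    z ∈ L ∨ z ∈ R ∨ z ∈ G \ {a, b} := by
  by_cases hzG : z ∈ G
  · refine Or.inr (Or.inr ⟨hzG, ?_⟩)
    rintro (rfl | rfl)
    · exact ha hz
    · exact hb hz
  · have : z ∈ L ∪ R := hLR ▸ ⟨hz, hzG⟩
    rcases this with h | h
    · exact Or.inl h
    · exact Or.inr (Or.inl h)

/-- The banks miss the chord and lie in `Ω`. [folklore] -/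
theorem bank_subset (hLR : L ∪ R = Ω \ G) : L ⊆ Ω \ G ∧ R ⊆ Ω \ G :=
  ⟨fun _ hz => hLR ▸ Or.inl hz, fun _ hz => hLR ▸ Or.inr hz⟩

variable [DecidablePred (· ∈ L)]

/-- The glued map is `T_L` on `L ∪ (G ∖ {a, b})`. [folklore] -/
theorem glued_eq_left (hagree : EqOn TL TR (G \ {a, b})) :
    EqOn (L.piecewise TL TR) TL (L ∪ G \ {a, b}) := by
  intro z hz
  by_cases hzL : z ∈ L
  · exact piecewise_eq_of_mem _ _ _ hzL
  · rw [piecewise_eq_of_notMem _ _ _ hzL]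
    rcases hz with h | h
    · exact absurd h hzL
    · exact (hagree h).symm

/-- The glued map is `T_R` on `R`. [folklore] -/
theorem glued_eq_right (hLRd : Disjoint L R) : EqOn (L.piecewise TL TR) TR R := fun _ hz =>
  piecewise_eq_of_notMem _ _ _ (Disjoint.notMem_of_mem_right hLRd hz)

/-- **Continuity of the glued map** on `Ω` (pasting along `Ω ∩ ∂L ⊆ G ∖ {a, b}`, where the two
maps agree). [folklore] -/
theorem continuousOn_glued (hLR : L ∪ R = Ω \ G) (ha : a ∉ Ω) (hb : b ∉ Ω) (hLo : IsOpen L)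
    (hfrL : Ω ∩ frontier L ⊆ G) (hGR : G \ {a, b} ⊆ closure R)
    (hTLc : ContinuousOn TL (closure L)) (hTRc : ContinuousOn TR (closure R))
    (hagree : EqOn TL TR (G \ {a, b})) : ContinuousOn (L.piecewise TL TR) Ω := by
  refine ContinuousOn.piecewise ?_ (hTLc.mono inter_subset_right) (hTRc.mono ?_)
  · rintro z ⟨hzΩ, hzfr⟩
    refine hagree ⟨hfrL ⟨hzΩ, hzfr⟩, ?_⟩
    rintro (rfl | rfl)
    · exact ha hzΩ
    · exact hb hzΩ
  · rintro z ⟨hzΩ, hzc⟩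
    have hzL : z ∉ L := by
      have : closure Lᶜ = Lᶜ := hLo.isClosed_compl.closure_eq
      rw [this] at hzc
      exact hzc
    rcases mem_cases hLR ha hb hzΩ with h | h | h
    · exact absurd h hzL
    · exact subset_closure h
    · exact hGR h

/-- **Holomorphy of the glued map off the chord**: on the open banks it agrees with the
holomorphic transition maps. [folklore] -/
theorem differentiableOn_glued (hLR : L ∪ R = Ω \ G) (hLRd : Disjoint L R) (hLo : IsOpen L)
    (hRo : IsOpen R) (hTLd : DifferentiableOn ℂ TL L) (hTRd : DifferentiableOn ℂ TR R)
    (hagree : EqOn TL TR (G \ {a, b})) : DifferentiableOn ℂ (L.piecewise TL TR) (Ω \ G) := by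
  have hL : DifferentiableOn ℂ (L.piecewise TL TR) L :=
    hTLd.congr fun z hz => glued_eq_left hagree (Or.inl hz)
  have hR : DifferentiableOn ℂ (L.piecewise TL TR) R :=
    hTRd.congr fun z hz => glued_eq_right hLRd hz
  rw [← hLR]
  rintro z (hz | hz)
  · exact (hL.differentiableAt (hLo.mem_nhds hz)).differentiableWithinAt
  · exact (hR.differentiableAt (hRo.mem_nhds hz)).differentiableWithinAt

variable {eψ eψ' : ℝ → ℂ} {X : Set ℝ}

/-- **The glued map carries the chord onto the chord**: `F (eψ x) = eψ' x` on the ray `X`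
parametrising `G ∖ {a, b}` (by `eψ`) and `G' ∖ {a, b}` (by `eψ'`). [folklore] -/
theorem image_chord_glued (hLR : L ∪ R = Ω \ G)
    (hTRψ : ∀ x : ℝ, TR (eψ x) = eψ' x) (hray : ∀ x ∈ X, eψ x ∈ G \ {a, b})
    (hsurj : ∀ z ∈ G \ {a, b}, ∃ x ∈ X, eψ x = z) (hray' : ∀ x ∈ X, eψ' x ∈ G' \ {a, b})
    (hsurj' : ∀ z ∈ G' \ {a, b}, ∃ x ∈ X, eψ' x = z) :
    L.piecewise TL TR '' (G \ {a, b}) = G' \ {a, b} := by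
  have hval : ∀ x ∈ X, L.piecewise TL TR (eψ x) = eψ' x := fun x hx => by
    have hzL : eψ x ∉ L := fun h => ((bank_subset hLR).1 h).2 (hray x hx).1
    rw [piecewise_eq_of_notMem _ _ _ hzL, hTRψ]
  apply Subset.antisymm
  · rintro _ ⟨z, hz, rfl⟩
    obtain ⟨x, hx, rfl⟩ := hsurj z hz
    rw [hval x hx]
    exact hray' x hx
  · intro z' hz'
    obtain ⟨x, hx, rfl⟩ := hsurj' z' hz'
    exact ⟨eψ x, hray x hx, hval x hx⟩

/-- **The glued map is a bijection of `Ω`, I: injectivity.** The three pieces `L`, `R`,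
`G ∖ {a, b}` are mapped injectively into the pairwise disjoint sets `L'`, `R'`, `G' ∖ {a, b}`.
[folklore] -/
theorem injOn_glued (hLR : L ∪ R = Ω \ G) (hLRd : Disjoint L R) (ha : a ∉ Ω) (hb : b ∉ Ω)
    (hLR' : L' ∪ R' = Ω \ G') (hLRd' : Disjoint L' R')
    (hTLb : BijOn TL L L') (hTRb : BijOn TR R R')
    (hTRψ : ∀ x : ℝ, TR (eψ x) = eψ' x) (heψ' : Function.Injective eψ')
    (hray : ∀ x ∈ X, eψ x ∈ G \ {a, b}) (hsurj : ∀ z ∈ G \ {a, b}, ∃ x ∈ X, eψ x = z)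
    (hray' : ∀ x ∈ X, eψ' x ∈ G' \ {a, b}) :
    InjOn (L.piecewise TL TR) Ω := by
  set F := L.piecewise TL TR with hF
  have hFL : ∀ z ∈ L, F z = TL z := fun z hz => piecewise_eq_of_mem _ _ _ hz
  have hFR : ∀ z ∈ R, F z = TR z := fun z hz => glued_eq_right hLRd hz
  have hFG : ∀ x ∈ X, F (eψ x) = eψ' x := fun x hx => by
    have hzL : eψ x ∉ L := fun h => ((bank_subset hLR).1 h).2 (hray x hx).1
    show L.piecewise TL TR (eψ x) = eψ' x
    rw [piecewise_eq_of_notMem _ _ _ hzL, hTRψ]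
  -- where each piece goes
  have hmapL : ∀ z ∈ L, F z ∈ L' := fun z hz => (hFL z hz).symm ▸ hTLb.mapsTo hz
  have hmapR : ∀ z ∈ R, F z ∈ R' := fun z hz => (hFR z hz).symm ▸ hTRb.mapsTo hz
  have hmapG : ∀ z ∈ G \ {a, b}, F z ∈ G' \ {a, b} := fun z hz => by
    obtain ⟨x, hx, rfl⟩ := hsurj z hz
    rw [hFG x hx]
    exact hray' x hx
  have hL'G' : ∀ w ∈ L', w ∉ G' \ {a, b} := fun w hw h => ((bank_subset hLR').1 hw).2 h.1
  have hR'G' : ∀ w ∈ R', w ∉ G' \ {a, b} := fun w hw h => ((bank_subset hLR').2 hw).2 h.1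
  have hLG : ∀ z ∈ L, z ∉ G \ {a, b} := fun z hz h => ((bank_subset hLR).1 hz).2 h.1
  have hRG : ∀ z ∈ R, z ∉ G \ {a, b} := fun z hz h => ((bank_subset hLR).2 hz).2 h.1
  -- membership of the pieces is detected by the image
  have hiffL : ∀ z ∈ Ω, (z ∈ L ↔ F z ∈ L') := fun z hz => by
    refine ⟨hmapL z, fun h => ?_⟩
    rcases mem_cases hLR ha hb hz with h' | h' | h'
    · exact h'
    · exact absurd (hmapR z h') (Disjoint.notMem_of_mem_left hLRd' h)
    · exact absurd (hmapG z h') (hL'G' _ h)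
  have hiffR : ∀ z ∈ Ω, (z ∈ R ↔ F z ∈ R') := fun z hz => by
    refine ⟨hmapR z, fun h => ?_⟩
    rcases mem_cases hLR ha hb hz with h' | h' | h'
    · exact absurd (hmapL z h') (Disjoint.notMem_of_mem_right hLRd' h)
    · exact h'
    · exact absurd (hmapG z h') (hR'G' _ h)
  intro z₁ hz₁ z₂ hz₂ heq
  rcases mem_cases hLR ha hb hz₁ with h₁ | h₁ | h₁
  · have h₂ : z₂ ∈ L := (hiffL z₂ hz₂).2 (heq ▸ (hiffL z₁ hz₁).1 h₁)
    rw [hFL z₁ h₁, hFL z₂ h₂] at heq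
    exact hTLb.injOn h₁ h₂ heq
  · have h₂ : z₂ ∈ R := (hiffR z₂ hz₂).2 (heq ▸ (hiffR z₁ hz₁).1 h₁)
    rw [hFR z₁ h₁, hFR z₂ h₂] at heq
    exact hTRb.injOn h₁ h₂ heq
  · have h₂ : z₂ ∈ G \ {a, b} := by
      rcases mem_cases hLR ha hb hz₂ with h₂ | h₂ | h₂
      · exact absurd ((hiffL z₁ hz₁).2 (heq.symm ▸ (hiffL z₂ hz₂).1 h₂)) (hLG z₁ · h₁)
      · exact absurd ((hiffR z₁ hz₁).2 (heq.symm ▸ (hiffR z₂ hz₂).1 h₂)) (hRG z₁ · h₁)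
      · exact h₂
    obtain ⟨x₁, hx₁, rfl⟩ := hsurj z₁ h₁
    obtain ⟨x₂, hx₂, rfl⟩ := hsurj z₂ h₂
    rw [hFG x₁ hx₁, hFG x₂ hx₂] at heq
    rw [heψ' heq]

/-- **The glued map is a bijection of `Ω`, II: the image is `Ω`.** [folklore] -/
theorem image_glued (hLR : L ∪ R = Ω \ G) (hLRd : Disjoint L R) (ha : a ∉ Ω) (hb : b ∉ Ω)
    (hLR' : L' ∪ R' = Ω \ G') (hG : G \ {a, b} ⊆ Ω) (hG' : G' \ {a, b} ⊆ Ω)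
    (hTLb : BijOn TL L L') (hTRb : BijOn TR R R')
    (hTRψ : ∀ x : ℝ, TR (eψ x) = eψ' x)
    (hray : ∀ x ∈ X, eψ x ∈ G \ {a, b}) (hsurj : ∀ z ∈ G \ {a, b}, ∃ x ∈ X, eψ x = z)
    (hray' : ∀ x ∈ X, eψ' x ∈ G' \ {a, b}) (hsurj' : ∀ z ∈ G' \ {a, b}, ∃ x ∈ X, eψ' x = z) :
    L.piecewise TL TR '' Ω = Ω := by
  set F := L.piecewise TL TR with hF
  have hFL : ∀ z ∈ L, F z = TL z := fun z hz => piecewise_eq_of_mem _ _ _ hz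
  have hFR : ∀ z ∈ R, F z = TR z := fun z hz => glued_eq_right hLRd hz
  have hFG : F '' (G \ {a, b}) = G' \ {a, b} :=
    image_chord_glued hLR hTRψ hray hsurj hray' hsurj'
  have hL'Ω : L' ⊆ Ω := fun w hw => ((bank_subset hLR').1 hw).1
  have hR'Ω : R' ⊆ Ω := fun w hw => ((bank_subset hLR').2 hw).1
  apply Subset.antisymm
  · rintro _ ⟨z, hz, rfl⟩
    rcases mem_cases hLR ha hb hz with h | h | h
    · rw [hFL z h]
      exact hL'Ω (hTLb.mapsTo h)
    · rw [hFR z h]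
      exact hR'Ω (hTRb.mapsTo h)
    · exact hG' (hFG ▸ mem_image_of_mem F h)
  · intro w hw
    rcases mem_cases hLR' ha hb hw with h | h | h
    · obtain ⟨z, hz, rfl⟩ := hTLb.surjOn h
      exact ⟨z, ((bank_subset hLR).1 hz).1, hFL z hz⟩
    · obtain ⟨z, hz, rfl⟩ := hTRb.surjOn h
      exact ⟨z, ((bank_subset hLR).2 hz).1, hFR z hz⟩
    · have hw' : w ∈ F '' (G \ {a, b}) := by
        rw [hFG]
        exact h
      obtain ⟨z, hz, rfl⟩ := hw'
      exact ⟨z, hG hz, rfl⟩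

omit [DecidablePred (· ∈ L)] in
/-- **Boundary limits of the glued map.** If `Ω ⊆ E ∪ R` with `E ⊆ L̄`, `F = T_L` on `E` and
`F = T_R` on `R`, and the continuous extensions fix the point `p` (wherever `p` is adherent),
then `F → p` at `p` within `Ω`. [folklore] -/
theorem tendsto_glued {F : ℂ → ℂ} {E : Set ℂ} {p : ℂ} (hΩ : Ω ⊆ E ∪ R) (hE : E ⊆ closure L)
    (hFL : EqOn F TL E) (hFR : EqOn F TR R)
    (hTL : ContinuousOn TL (closure L)) (hTR : ContinuousOn TR (closure R))
    (hpL : p ∈ closure L → TL p = p) (hpR : p ∈ closure R → TR p = p) :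
    Tendsto F (𝓝[Ω] p) (𝓝 p) := by
  have key : ∀ {S C : Set ℂ} {T : ℂ → ℂ}, S ⊆ closure C → EqOn F T S →
      ContinuousOn T (closure C) → (p ∈ closure C → T p = p) → Tendsto F (𝓝[S] p) (𝓝 p) := by
    intro S C T hS hFT hT hp
    by_cases hpc : p ∈ closure C
    · have h1 : Tendsto T (𝓝[S] p) (𝓝 (T p)) := (hT p hpc).tendsto.mono_left (nhdsWithin_mono p hS)
      rw [hp hpc] at h1
      exact h1.congr' hFT.eventuallyEq_nhdsWithin.symm
    · have hbot : 𝓝[S] p = ⊥ := by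
        refine not_neBot.1 fun h => hpc ?_
        have hp' : p ∈ closure S := mem_closure_iff_nhdsWithin_neBot.2 h
        have : closure S ⊆ closure C := (closure_mono hS).trans closure_closure.subset
        exact this hp'
      rw [hbot]
      exact tendsto_bot
  have h1 : Tendsto F (𝓝[E] p) (𝓝 p) := key hE hFL hTL hpL
  have h2 : Tendsto F (𝓝[R] p) (𝓝 p) := key subset_closure hFR hTR hpR
  have hle : 𝓝[Ω] p ≤ 𝓝[E ∪ R] p := nhdsWithin_mono p hΩ
  rw [nhdsWithin_union] at hle
  exact (h1.sup h2).mono_left hle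

end Glued

end Summit.CriticalPhenomena.SAWScalingLimit.Theorems.WeldingRigidity
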